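import Summits.CriticalPhenomena.PercolationContinuityZ3.Theorems.Transplant.FKDoubleFanCrossFar
import Summits.CriticalPhenomena.PercolationContinuityZ3.Theorems.Transplant.FKDoubleFanWedge
import Summits.CriticalPhenomena.PercolationContinuityZ3.Theorems.Transplant.FKDoubleFanSpokesAdjacent
import Summits.CriticalPhenomena.PercolationContinuityZ3.Theorems.Transplant.FKThreeApexPinned
import HarnessLib

/-!
# Double fans `K₂ ∨ P_{m+1}`, far cross-apex pairs with a ONE-SIDED middle: the Rayleigh difference is an explicit quadratic form in the
# FAN VECTOR of the middle — a finite-dimensional reduction valid at EVERY distance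

Helper file (`--supports stmt-CriticalPhenomena-4575`), FK sub-lane `prim-bschramm-fk-3` (gen 31); builds on p205010 (kernel theorem, internal
audit signed; external expert review pending).  Pure real algebra, no sorries; standard axioms.  Memo `bschramm/prim-bschramm-fk-3/FAR-CROSS-VI.md` §10.

Setting of `…DoubleFanCrossFar`: the pair `(a c_j, b c_k)`, `k − j = d + 1`, pinned partition functions `crossFarZ q mids rd u s σ τ` with `u, s ∈ InKE q`
and `mids` the list of middle blocks `(r_i, x_i, y_i)`.  This file treats the ONE-SIDED middles: `y_i = 0` for every block (no `b`-spoke strictly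
between the two pinned spokes; by the `a ↔ b`/reversal symmetry the case `x_i = 0` is the same problem).  The middle is then a FAN with apex `a`
between `c_j` and `c_k`, and in hat coordinates the middle word is an element of the five-dimensional algebra spanned by
`{id, P_a, detach, detach ∘ P_a, P_a ∘ detach}` (`P_a = AC_1 ∗ ·`; relations `P_a² = P_a`, `detach² = q·detach`, `P_a detach P_a = P_a`,
`detach P_a detach = detach`).  Its five coefficients form the **fan vector** — which is, LITERALLY, the `InKE` vector of the fan read in the
three-apex language of the triple `(c_j, a, c)` (`Z₀ ↔ detach`, `Z_ab ↔ detach∘P_a`, `Z_ac ↔ id`, `Z_bc ↔ P_a∘detach`, `Z₁ ↔ P_a`):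
**`fanVec`** is built from `AC_1 ∗ δ₀` by the rim steps `r_i` and the letters `BC_{x_i}` (the `a`-spokes of the double fan are the `b c`-edges of that
triple), hence **`fanVec_inKE`** / **`fullFanVec_inKE`** (blocks with weights in `[0,1]`, `UnitBlocks`): it lies in `InKE q` and so satisfies `Valid` and the
three `U`-conditions (`…ThreeApexRimStep`, `…UCondRimStep`).
Main identities:
* **`midWord_oneSided`**: for one-sided `mids` (every `y_i = 0`), `midWord q mids (fanCombo q F X) = fanCombo q (fanVec q mids F) X`, where
  `fanCombo q F X = F_ac·X + F₁·P_aX + F₀·detach X + F_ab·detach(P_aX) + F_bc·P_a(detach X)`; with `F = AC_1 ∗ δ₀` (`fanCombo = id`) this expresses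
  the middle word through the fan vector (**`midWord_oneSided_init`**, **`rimStep_fanCombo`**);
* **`rayleigh_crossFar_oneSided`**: for one-sided `mids`,
  `Z¹⁰Z⁰¹ − Z¹¹Z⁰⁰ = q²·Φ_q(F; u, s)`, `F = rimStep q rd (fanVec q mids (AC_1 ∗ δ₀))`, with **`fanPhi`** the EXPLICIT quadratic form in `F` whose
  coefficients are bilinear in the hat products of `u` and `s`: `N^{ab}(u∗s)`-type `A(u,s) = x̂v̂x̂'v̂' + pŷẑŷ'ẑ' − (1+p)ûv̂û'v̂'`, `N^{(bc)}(u)`, `N^{(ac)}(s)`, …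
  (`p = 1−q`); only ONE of its fifteen coefficients (`F₁F₀`, i.e. `P_a × detach`) can be negative, and `G[P_a,detach] + G[detach P_a, P_a detach] =
  p·N^{(bc)}(u)·v̂'(ŷ' − (1+p)û'/2) ≥ 0`.
CONSEQUENCE (memo §10): cross-apex negative correlation at ALL distances across one-sided middles is EQUIVALENT to the single finite-dimensional
inequality `Φ_q(F; u, s) ≥ 0` for `F` ranging over fan vectors and `u, s ∈ InKE q`; numerically `Φ_q ≥ 0` holds on the whole relaxation
`F ∈ Valid ∧ U` (0 negatives, q ∈ {1/5, 1/2, 9/10}), so the one-sided theorem is reduced to ONE inequality of the kind proved in `…CrossApexInKE`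
(the adjacent pair is the special case `F = (1−r, 0, r, 0, 0)`).
[cite: Grimmett2006, §3.9 eq. (3.94) (pp. 63–64)] [folklore]
-/

noncomputable section

namespace Summit.CriticalPhenomena.PercolationContinuityZ3.Theorems

namespace FK

namespace ThreeApex

/-! ### The fan algebra acting on a prefix vector -/

/-- The element `F_ac·id + F₁·P_a + F₀·detach + F_ab·(detach ∘ P_a) + F_bc·(P_a ∘ detach)` of the fan algebra applied to `X`
(`P_a X = AC_1 ∗ X`). [folklore] -/
def fanCombo (q : ℝ) (F X : V5) : V5 :=
  ⟨F.zac * X.z0 + F.z1 * (conv (edgeAC 1) X).z0 + F.z0 * (detach q X).z0 + F.zab * (detach q (conv (edgeAC 1) X)).z0 +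
      F.zbc * (conv (edgeAC 1) (detach q X)).z0,
    F.zac * X.zab + F.z1 * (conv (edgeAC 1) X).zab + F.z0 * (detach q X).zab + F.zab * (detach q (conv (edgeAC 1) X)).zab +
      F.zbc * (conv (edgeAC 1) (detach q X)).zab,
    F.zac * X.zac + F.z1 * (conv (edgeAC 1) X).zac + F.z0 * (detach q X).zac + F.zab * (detach q (conv (edgeAC 1) X)).zac +
      F.zbc * (conv (edgeAC 1) (detach q X)).zac,
    F.zac * X.zbc + F.z1 * (conv (edgeAC 1) X).zbc + F.z0 * (detach q X).zbc + F.zab * (detach q (conv (edgeAC 1) X)).zbc +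
      F.zbc * (conv (edgeAC 1) (detach q X)).zbc,
    F.zac * X.z1 + F.z1 * (conv (edgeAC 1) X).z1 + F.z0 * (detach q X).z1 + F.zab * (detach q (conv (edgeAC 1) X)).z1 +
      F.zbc * (conv (edgeAC 1) (detach q X)).z1⟩

/-- The initial fan vector `AC_1 ∗ δ₀ = (0,0,1,0,0)` (the block `{c_j c}`: the moving vertex IS `c_j`). [folklore] -/
def fanInit : V5 := conv (edgeAC 1) delta0

/-- `fanInit = (0, 0, 1, 0, 0)`. [folklore] -/
theorem fanInit_eq : fanInit = ⟨0, 0, 1, 0, 0⟩ := by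
  ext <;> simp [fanInit, conv, edgeAC, delta0, V5.total]

/-- With the initial fan vector the combination is the identity. [folklore] -/
theorem fanCombo_init (q : ℝ) (X : V5) : fanCombo q fanInit X = X := by
  rw [fanInit_eq]; ext <;> simp [fanCombo]

/-- **The fan vector of a one-sided middle**: starting from `F`, each block `(r, x, y)` acts by the rim step `r` and then the letter `BC_x`
(the `a`-spoke of the double fan is the `bc`-edge of the triple `(c_j, a, c)`); the `y`-entry is ignored (it is `0` for one-sided middles). [folklore] -/
def fanVec (q : ℝ) : List (ℝ × ℝ × ℝ) → V5 → V5
  | [], F => F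
  | blk :: rest, F => fanVec q rest (conv (edgeBC blk.2.1) (rimStep q blk.1 F))

/-- **The fan vector is a genuine `InKE` vector** (of the triple `(c_j, a, c)`), for every starting vector in `InKE q`. [folklore] -/
theorem fanVec_inKE {q : ℝ} : ∀ {l : List (ℝ × ℝ × ℝ)}, UnitBlocks l → ∀ {F : V5}, InKE q F → InKE q (fanVec q l F) := by
  intro l
  induction l with
  | nil => intro _ F hF; simpa [fanVec] using hF
  | cons blk rest ih =>
    intro hl F hF
    have hb := hl blk (by simp)
    have hrest : UnitBlocks rest := fun b hb' => hl b (by simp [hb'])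
    simp only [fanVec]
    exact ih hrest (InKE.step (IsLetter.bc hb.2.2.1 hb.2.2.2.1) (InKE.rim hb.1 hb.2.1 hF))

/-- `fanInit ∈ InKE q`. [folklore] -/
theorem fanInit_inKE (q : ℝ) : InKE q fanInit :=
  InKE.step (IsLetter.ac zero_le_one le_rfl) InKE.base

/-- **The full fan vector** `rimStep q rd (fanVec q mids fanInit)` of a one-sided middle lies in `InKE q` (`rd ∈ [0,1]`). [folklore] -/
theorem fullFanVec_inKE {q : ℝ} {mids : List (ℝ × ℝ × ℝ)} (hm : UnitBlocks mids) {rd : ℝ} (hrd0 : 0 ≤ rd) (hrd1 : rd ≤ 1) :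
    InKE q (rimStep q rd (fanVec q mids fanInit)) :=
  InKE.rim hrd0 hrd1 (fanVec_inKE hm (fanInit_inKE q))

/-! ### The algebra relations: one block maps `fanCombo F` to `fanCombo (block-image of F)` -/

/-- **Rim step**: `E_r (fanCombo F X) = fanCombo (E_r F) X` (uses `detach² = q·detach`, `detach P_a detach = detach`). [folklore] -/
theorem rimStep_fanCombo (q r : ℝ) (F X : V5) : rimStep q r (fanCombo q F X) = fanCombo q (rimStep q r F) X := by
  ext <;> simp only [rimStep, fanCombo, conv, edgeAC, detach, V5.total] <;> ring

/-- **`a`-spoke**: `AC_x ∗ (fanCombo F X) = fanCombo (BC_x ∗ F) X` (uses `P_a² = P_a`, `P_a detach P_a = P_a`). [folklore] -/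
theorem conv_edgeAC_fanCombo (q x : ℝ) (F X : V5) : conv (edgeAC x) (fanCombo q F X) = fanCombo q (conv (edgeBC x) F) X := by
  ext <;> simp only [fanCombo, conv, edgeAC, edgeBC, detach, V5.total] <;> ring

/-- `s ∗ BC_0 = s`. [folklore] -/
theorem conv_edgeBC_zero_right' (s : V5) : conv s (edgeBC 0) = s := by
  ext <;> simp [conv, edgeBC, V5.total]

/-- Hat coordinates of `P_a X = AC_1 ∗ X` are `(0,0,ŷ,0,v̂)` (`z0`). [folklore] -/
theorem hatAC_z0 (X : V5) : (conv (edgeAC 1) X).z0 = 0 := by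
  simp only [conv, edgeAC]; ring

/-- Hat coordinates of `P_a X = AC_1 ∗ X` are `(0,0,ŷ,0,v̂)` (`hx`). [folklore] -/
theorem hatAC_hx (X : V5) : hx (conv (edgeAC 1) X) = 0 := by
  simp only [conv, edgeAC, hx]; ring

/-- Hat coordinates of `P_a X = AC_1 ∗ X` are `(0,0,ŷ,0,v̂)` (`hy`). [folklore] -/
theorem hatAC_hy (X : V5) : hy (conv (edgeAC 1) X) = hy X := by
  simp only [conv, edgeAC, hy]; ring

/-- Hat coordinates of `P_a X = AC_1 ∗ X` are `(0,0,ŷ,0,v̂)` (`hz`). [folklore] -/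
theorem hatAC_hz (X : V5) : hz (conv (edgeAC 1) X) = 0 := by
  simp only [conv, edgeAC, hz]; ring

/-- Hat coordinates of `P_a X = AC_1 ∗ X` are `(0,0,ŷ,0,v̂)` (`total`). [folklore] -/
theorem hatAC_total (X : V5) : (conv (edgeAC 1) X).total = X.total := by
  simp only [conv, edgeAC, V5.total]; ring

/-- Hat coordinates of `detach X` are `(α,φ,α,α,φ)`, `α = ŷ+ẑ−(2−q)Z₀`, `φ = v̂−(1−q)x̂` (`z0`). [folklore] -/
theorem hatDetach_z0 (q : ℝ) (X : V5) : (detach q X).z0 = hy X + hz X - (2 - q) * X.z0 := by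
  simp only [detach, hy, hz]; ring

/-- Hat coordinates of `detach X` are `(α,φ,α,α,φ)`, `α = ŷ+ẑ−(2−q)Z₀`, `φ = v̂−(1−q)x̂` (`hx`). [folklore] -/
theorem hatDetach_hx (q : ℝ) (X : V5) : hx (detach q X) = X.total - (1 - q) * hx X := by
  simp only [detach, hx, V5.total]; ring

/-- Hat coordinates of `detach X` are `(α,φ,α,α,φ)`, `α = ŷ+ẑ−(2−q)Z₀`, `φ = v̂−(1−q)x̂` (`hy`). [folklore] -/
theorem hatDetach_hy (q : ℝ) (X : V5) : hy (detach q X) = hy X + hz X - (2 - q) * X.z0 := by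
  simp only [detach, hy, hz]; ring

/-- Hat coordinates of `detach X` are `(α,φ,α,α,φ)`, `α = ŷ+ẑ−(2−q)Z₀`, `φ = v̂−(1−q)x̂` (`hz`). [folklore] -/
theorem hatDetach_hz (q : ℝ) (X : V5) : hz (detach q X) = hy X + hz X - (2 - q) * X.z0 := by
  simp only [detach, hy, hz]; ring

/-- Hat coordinates of `detach X` are `(α,φ,α,α,φ)`, `α = ŷ+ẑ−(2−q)Z₀`, `φ = v̂−(1−q)x̂` (`total`). [folklore] -/
theorem hatDetach_total (q : ℝ) (X : V5) : (detach q X).total = X.total - (1 - q) * hx X := by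
  simp only [detach, hx, V5.total]; ring

/-- Hat coordinates of `s ∗ BC_1 = P_b s` are `(0,0,0,ẑ',v̂')` (`z0`). [folklore] -/
theorem hatBCr_z0 (s : V5) : (conv s (edgeBC 1)).z0 = 0 := by
  simp only [conv, edgeBC]; ring

/-- Hat coordinates of `s ∗ BC_1 = P_b s` are `(0,0,0,ẑ',v̂')` (`hx`). [folklore] -/
theorem hatBCr_hx (s : V5) : hx (conv s (edgeBC 1)) = 0 := by
  simp only [conv, edgeBC, hx]; ring

/-- Hat coordinates of `s ∗ BC_1 = P_b s` are `(0,0,0,ẑ',v̂')` (`hy`). [folklore] -/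
theorem hatBCr_hy (s : V5) : hy (conv s (edgeBC 1)) = 0 := by
  simp only [conv, edgeBC, hy]; ring

/-- Hat coordinates of `s ∗ BC_1 = P_b s` are `(0,0,0,ẑ',v̂')` (`hz`). [folklore] -/
theorem hatBCr_hz (s : V5) : hz (conv s (edgeBC 1)) = hz s := by
  simp only [conv, edgeBC, hz]; ring

/-- Hat coordinates of `s ∗ BC_1 = P_b s` are `(0,0,0,ẑ',v̂')` (`total`). [folklore] -/
theorem hatBCr_total (s : V5) : (conv s (edgeBC 1)).total = s.total := by
  simp only [conv, edgeBC, V5.total]; ring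

/-- **The middle word of a one-sided middle through the fan vector** (general starting fan vector). [folklore] -/
theorem midWord_oneSided (q : ℝ) :
    ∀ {mids : List (ℝ × ℝ × ℝ)}, (∀ blk ∈ mids, blk.2.2 = 0) → ∀ F X : V5, midWord q mids (fanCombo q F X) = fanCombo q (fanVec q mids F) X := by
  intro mids
  induction mids with
  | nil => intro _ F X; simp [midWord, fanVec]
  | cons blk rest ih =>
    intro hm F X
    have hb : blk.2.2 = 0 := hm blk (by simp)
    have hrest : ∀ b ∈ rest, b.2.2 = 0 := fun b hb' => hm b (by simp [hb'])
    simp only [midWord, fanVec, hb, conv_edgeBC_zero, rimStep_fanCombo, conv_edgeAC_fanCombo]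
    exact ih hrest _ X

/-- The middle word from the initial fan vector: `midWord q mids X = fanCombo (fanVec q mids fanInit) X`. [folklore] -/
theorem midWord_oneSided_init (q : ℝ) {mids : List (ℝ × ℝ × ℝ)} (hm : ∀ blk ∈ mids, blk.2.2 = 0) (X : V5) :
    midWord q mids X = fanCombo q (fanVec q mids fanInit) X := by
  have h := midWord_oneSided q hm fanInit X
  rwa [fanCombo_init] at h

/-! ### The explicit quadratic form -/

/-- Linearity of the gluing pairing in the fan-algebra coefficients:
`val(S ∗ fanCombo F X) = F_ac·val(S∗X) + F₁·val(S∗P_aX) + F₀·val(S∗detach X) + F_ab·val(S∗detach(P_aX)) + F_bc·val(S∗P_a(detach X))`. [folklore] -/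
theorem val_conv_fanCombo (q : ℝ) (S F X : V5) :
    val q (conv S (fanCombo q F X)) =
      F.zac * val q (conv S X) + F.z1 * val q (conv S (conv (edgeAC 1) X)) + F.z0 * val q (conv S (detach q X)) +
        F.zab * val q (conv S (detach q (conv (edgeAC 1) X))) + F.zbc * val q (conv S (conv (edgeAC 1) (detach q X))) := by
  simp only [fanCombo, val, conv, V5.total]; ring

/-- The pinned partition functions of a one-sided middle through the full fan vector `F = E_{r_d}(fanVec mids fanInit)`:
`Z^{στ} = val((s ∗ BC_τ) ∗ fanCombo F (AC_σ ∗ u))`. [folklore] -/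
theorem crossFarZ_oneSided (q : ℝ) {mids : List (ℝ × ℝ × ℝ)} (hm : ∀ blk ∈ mids, blk.2.2 = 0) (rd : ℝ) (u s : V5) (σ τ : ℝ) :
    crossFarZ q mids rd u s σ τ =
      val q (conv (conv s (edgeBC τ)) (fanCombo q (rimStep q rd (fanVec q mids fanInit)) (conv (edgeAC σ) u))) := by
  simp only [crossFarZ, midWord_oneSided_init q hm, rimStep_fanCombo, ← mul_def, ← mul_assoc]

/-- The gluing pairing against `s ∗ BC_τ` in hat coordinates:
`val((s ∗ BC_τ) ∗ Y) = q·[(1−q)(2−q)(1−τ)ŝ₀Y₀ − (1−q)((1−τ)x̂_s x̂_Y + (1−τ)ŷ_s ŷ_Y + ẑ_s ẑ_Y) + v̂_s v̂_Y]`. [folklore] -/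
theorem val_glue_hat (q τ : ℝ) (s Y : V5) :
    val q (conv (conv s (edgeBC τ)) Y) =
      q * ((1 - q) * (2 - q) * ((1 - τ) * s.z0) * Y.z0 -
        (1 - q) * ((1 - τ) * hx s * hx Y + (1 - τ) * hy s * hy Y + hz s * hz Y) + s.total * Y.total) := by
  simp only [val, conv, edgeBC, hx, hy, hz, V5.total]; ring

/-- **`Φ_q(F; u, s)`**: the one-sided Rayleigh difference divided by `q²`, as a quadratic form in the fan vector `F = (F₀, F_ab, F_ac, F_bc, F₁)`
with coefficients bilinear in the hat products of `u` (`û = u.z0, x̂ = hx u, ŷ = hy u, ẑ = hz u, v̂ = u.total`) and of `s` (`p = 1−q`):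
`G[ac,ac] = pA` (`A = x̂v̂x̂'v̂' + pŷẑŷ'ẑ' − (1+p)ûv̂û'v̂'`), `G[ac,1] = pA/2`, `G[0,0] = pN^{(bc)}(u)N^{(ac)}(s)`, `G[0,ab] = G[0,0]/2`,
`G[bc,bc] = pN^{(bc)}(u)ŷ'v̂'`, `G[1,bc] = G[bc,bc]/2`, `G[0,bc] = pN^{(bc)}(u)v̂'(ŷ' − (1+p)û'/2)`, `G[ac,bc] = (pA + pN^{(bc)}(u)ŷ'v̂')/2`, the four mixed
entries `G[ac,0], G[ac,ab], G[1,0], G[ab,bc]` written out below, and `G[1,1] = G[1,ab] = G[ab,ab] = 0`; only `G[1,0]` can be negative. [folklore] -/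
def fanPhi (q : ℝ) (F u s : V5) : ℝ :=
  (1 - q) * (hx u * u.total * hx s * s.total + (1 - q) * hy u * hz u * hy s * hz s - (2 - q) * u.z0 * u.total * s.z0 * s.total) *
      (F.zac ^ 2 + F.zac * F.z1 + F.zac * F.zbc) +
    (1 - q) * (hz u * u.total - (2 - q) * u.z0 * u.total + (1 - q) * hx u * hy u) *
      ((hy s * s.total - (2 - q) * s.z0 * s.total + (1 - q) * hx s * hz s) * (F.z0 ^ 2 + F.z0 * F.zab) +
        hy s * s.total * (F.zbc ^ 2 + F.z1 * F.zbc + F.zac * F.zbc) + 2 * s.total * (hy s - (2 - q) / 2 * s.z0) * F.z0 * F.zbc) +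
    F.zac * F.z0 * (-(1 - q) * (2 - q) * (hz u * u.total - (1 - q) * u.z0 * u.total) * s.z0 * s.total +
        (1 - q) * (hz u * u.total - (2 - q) * u.z0 * u.total + (1 - q) * hx u * hy u) * hy s * s.total +
        (1 - q) ^ 2 * (2 - q) * (u.z0 * hy u - hy u * hz u) * s.z0 * hz s + (1 - q) ^ 2 * (2 * hy u * hz u - (2 - q) * u.z0 * hy u) * hy s * hz s +
        (1 - q) * q * hx u * u.total * hx s * s.total + (1 - q) ^ 2 * (hz u * u.total - hx u * hy u) * hx s * hz s) +
    F.zac * F.zab * ((1 - q) * hx u * u.total * hx s * s.total - (1 - q) * (2 - q) * u.z0 * u.total * s.z0 * s.total +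
        (1 - q) ^ 2 * (2 - q) * (u.z0 * hy u - hy u * hz u) * s.z0 * hz s + (1 - q) ^ 2 * (hz u * u.total - hx u * hy u) * hx s * hz s +
        (1 - q) ^ 2 * hy u * hz u * hy s * hz s) +
    F.z1 * F.z0 * ((1 - q) * (hz u * u.total - (2 - q) * u.z0 * u.total + (1 - q) * hx u * hy u) * hy s * s.total -
        (1 - q) * (2 - q) * (hz u * u.total - (2 - q) * u.z0 * u.total) * s.z0 * s.total +
        (1 - q) ^ 2 * (hy u * hz u - (2 - q) * u.z0 * hy u) * hy s * hz s - (1 - q) ^ 2 * hx u * u.total * hx s * s.total) +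
    F.zab * F.zbc * ((1 - q) * (hz u * u.total - (2 - q) * u.z0 * u.total + (1 - q) * hx u * hy u) * hy s * s.total +
        (1 - q) ^ 2 * ((2 - q) * u.z0 * hy u - hy u * hz u) * hy s * hz s + (1 - q) ^ 2 * hx u * u.total * hx s * s.total -
        (1 - q) ^ 2 * (2 - q) * hx u * hy u * s.z0 * s.total)

/-- The four pinned values as explicit bilinear expressions: with `F` fixed, `Z^{στ}` in hat coordinates. [folklore] -/
theorem crossFarZ_oneSided_hat (q : ℝ) {mids : List (ℝ × ℝ × ℝ)} (hm : ∀ blk ∈ mids, blk.2.2 = 0) (rd : ℝ) (u s : V5) (σ τ : ℝ) :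
    crossFarZ q mids rd u s σ τ =
      (rimStep q rd (fanVec q mids fanInit)).zac * val q (conv (conv s (edgeBC τ)) (conv (edgeAC σ) u)) +
      (rimStep q rd (fanVec q mids fanInit)).z1 * val q (conv (conv s (edgeBC τ)) (conv (edgeAC 1) (conv (edgeAC σ) u))) +
      (rimStep q rd (fanVec q mids fanInit)).z0 * val q (conv (conv s (edgeBC τ)) (detach q (conv (edgeAC σ) u))) +
      (rimStep q rd (fanVec q mids fanInit)).zab * val q (conv (conv s (edgeBC τ)) (detach q (conv (edgeAC 1) (conv (edgeAC σ) u)))) +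
      (rimStep q rd (fanVec q mids fanInit)).zbc * val q (conv (conv s (edgeBC τ)) (conv (edgeAC 1) (detach q (conv (edgeAC σ) u)))) := by
  rw [crossFarZ_oneSided q hm, val_conv_fanCombo]

/-- **THE ONE-SIDED REDUCTION.**  For a one-sided middle the cross-apex Rayleigh difference at any distance is `q²·Φ_q(F; u, s)` with `F` the
(genuine, `InKE`) fan vector of the middle. [folklore] -/
theorem rayleigh_crossFar_oneSided (q : ℝ) {mids : List (ℝ × ℝ × ℝ)} (hm : ∀ blk ∈ mids, blk.2.2 = 0) (rd : ℝ) (u s : V5) :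
    crossFarZ q mids rd u s 1 0 * crossFarZ q mids rd u s 0 1 - crossFarZ q mids rd u s 1 1 * crossFarZ q mids rd u s 0 0 =
      q ^ 2 * fanPhi q (rimStep q rd (fanVec q mids fanInit)) u s := by
  simp only [crossFarZ_oneSided q hm]
  generalize rimStep q rd (fanVec q mids fanInit) = F
  simp only [conv_edgeAC_zero, conv_edgeBC_zero_right']
  simp only [val_conv_fanCombo]
  simp only [val_conv_hat, hatAC_z0, hatAC_hx, hatAC_hy, hatAC_hz, hatAC_total, hatDetach_z0, hatDetach_hx, hatDetach_hy, hatDetach_hz,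
    hatDetach_total, hatBCr_z0, hatBCr_hx, hatBCr_hy, hatBCr_hz, hatBCr_total]
  simp only [fanPhi]
  ring

/-- The adjacent pair is the case of no middle block: then the fan vector is `E_{r_d}(AC_1 ∗ δ₀) = (1−r_d, 0, r_d, 0, 0)`. [folklore] -/
theorem fullFanVec_nil (q rd : ℝ) : rimStep q rd (fanVec q [] fanInit) = ⟨1 - rd, 0, rd, 0, 0⟩ := by
  rw [fanVec, fanInit_eq]; ext <;> simp [rimStep]

/-- **The one-sided far theorem follows from ONE inequality**: if `Φ_q(F; u, s) ≥ 0` for all `F, u, s ∈ InKE q`, then the pinned Rayleigh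
inequality holds across every one-sided middle, at every distance. [folklore] -/
theorem rayleigh_crossFar_oneSided_of_fanPhi {q : ℝ}
    (hΦ : ∀ F u s : V5, InKE q F → InKE q u → InKE q s → 0 ≤ fanPhi q F u s)
    {mids : List (ℝ × ℝ × ℝ)} (hm : UnitBlocks mids) (hy : ∀ blk ∈ mids, blk.2.2 = 0) {rd : ℝ} (hrd0 : 0 ≤ rd) (hrd1 : rd ≤ 1)
    {u s : V5} (hu : InKE q u) (hs : InKE q s) :
    0 ≤ crossFarZ q mids rd u s 1 0 * crossFarZ q mids rd u s 0 1 - crossFarZ q mids rd u s 1 1 * crossFarZ q mids rd u s 0 0 := by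
  rw [rayleigh_crossFar_oneSided q hy]
  exact mul_nonneg (sq_nonneg q) (hΦ _ _ _ (fullFanVec_inKE hm hrd0 hrd1) hu hs)

end ThreeApex

end FK

end Summit.CriticalPhenomena.PercolationContinuityZ3.Theorems
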